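import Mathlib
import HarnessLib
import HarnessLib.Audit
import Summits.CriticalPhenomena.Statement
import Literature.Probability.RandomPlanarGeometry.HexParafermion
import Literature.Probability.RandomPlanarGeometry.HexSAW
import Literature.Probability.RandomPlanarGeometry.SLEConvergenceCriterion
import Literature.Probability.RandomPlanarGeometry.ConformalMap
import Summits.CriticalPhenomena.SAWScalingLimit.Theorems.SAWDevelopingMapObservableToSLETypeLadderBandDefs
import HarnessLib.Audit.Status.Attr

/-!
Route: SAWDevelopingMap

DORMANT since 2026-08-26T05:04:15Z (reconciler: no traction for 8.4 d (last activity item-evidence-added at 2026-08-17T19:39:23Z); parked, not closed — `ledger route dormant route-CriticalPhenomena-SAWDevelopingMap --off` to reactivate) — unstaffed, not closed; items shared with open routes are served there. `ledger route dormant <id> --off` reactivates.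

# Route SAWDevelopingMap — the SAW parafermion never folds — F = dH for a PL map whose dilatation is
the missing half of Cauchy–Riemann; no folds + bulk flattening + qc rigidity give DCS Conjecture 2

It suffices to show X = (K) ∧ (M) ∧ (Id) for the Duminil-Copin–Smirnov parafermionic observable F =
F(a, ·, x_c, 5/8) of the
HEXAGONAL lattice (route realising idea card parafermion-developing-map-no-folds, its spine and only
card):
(K) NoFoldBound — there is one k < 1 such that for every simply connected hexagonal domain Λ, every
boundary source mid-edge a and
every vertex v of Λ with mid-edges p₀, p₁, p₂ (in ANY order), ‖F(p₀) + ωF(p₁) + ω²F(p₂)‖ ≤ k‖F(p₀) +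
F(p₁) + F(p₂)‖, ω = e^(2πi/3).
By DCS Lemma 1 (proved in the tree) one orientation class of labellings gives 0; the other is
|∂̄H|/|∂H| = |μ_v| for the developing
map H (F = dH, PotentialExists), so (K) says: the piecewise-linear map H never folds, with uniform
dilatation K = (1+k)/(1−k).
(M) InteriorFlattening — the same quotient is ≤ ε at every vertex whose lattice R(ε)-neighbourhood
lies in Λ, uniformly in (Λ, a):
DCS's "in the limit the curl vanishes … F_δ(z) having the same limit regardless of the orientation
of the edge z" (arXiv:1007.0575
p. 7), made pointwise.
(Id) QCIdentification — (K) and (M) imply DCS Conjecture 2 in the typed, averaged form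
HexObservableLimit, flat and rigid-rowed at
BOTH marked points (item HexObservableLimit: the route's first WAYPOINT and its TARGET #0 — derived
inside `closes` as QCIdentification hK hM,
never assumed; since rev 4 the repaired statement stmt-CriticalPhenomena-14003, shared verbatim with
SAWDefectDecoherence / SAWResidueField /
SAWPhaseRetrieval / SAWWindingAlias, replacing stmt-CriticalPhenomena-5420, refuted-misstated by a
corridor witness that relocated the
conformal root).
X feeds the summit through the shared hexagonal pipeline, all of it CRUX items: ObservableToSLE (+
HexTight) turns the first waypoint into
DCS Conjecture 1 written out (its text is the second waypoint item HexConjecture, a DERIVED crux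
here, shared with SAWBrickWallHomotopy /
SAWHexUniversality; ≡ Literature HexSAWScalingLimit), and the tail crux HexTransfer
(stmt-CriticalPhenomena-14221, shared with
SAWPhaseRetrieval / SAWWindingAlias: Conjecture 1 written out → the δℤ² Statement, i.e. lattice
universality in exactly the implicational
form the deciding theorem consumes) gives the δℤ² conjunct. Since rev 13 the tail is this ONE crux:
the rev-9–12 tail crux LatticeUniversality
(stmt-0807) is replaced 1:1 in THIS route by HexTransfer (restate, same rank 7) and the routine
supports HexEndpointApproxExists
(stmt-9864) + SquareTransfer (stmt-14521) are dropped from it (all three items stay with their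
sibling routes); together they are recorded
as the foreseen glued split of HexTransfer (TWO-LAYER PLAN; the glue hexTransfer_of :
HexEndpointApproxExists → LatticeUniversality →
HexTransfer is already sorry-free in the refuter evidence Reduction.lean on stmt-14221).
Lean: `(∃ k : ℝ, k < 1 ∧ ∀ (Λ : Finset Literature.Probability.LatticeModels.HexVertex),
Literature.Probability.RandomPlanarGeometry.SAW.hexDomainSimplyConnected Λ → ∀ a ∈
Literature.Probability.RandomPlanarGeometry.SAW.hexDomainBoundary Λ, ∀ v ∈ Λ, ∀ w₀ w₁ w₂ :
Literature.Probability.LatticeModels.HexVertex, Literature.Probability.LatticeModels.hexGraph.Adj v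
w₀ → Literature.Probability.LatticeModels.hexGraph.Adj v w₁ →
Literature.Probability.LatticeModels.hexGraph.Adj v w₂ → w₀ ≠ w₁ → w₁ ≠ w₂ → w₀ ≠ w₂ → let F : Sym2
Literature.Probability.LatticeModels.HexVertex → ℂ :=
Literature.Probability.RandomPlanarGeometry.SAW.hexParafermionicObservable Λ a
Literature.Probability.RandomPlanarGeometry.SAW.hexCriticalFugacity (5 / 8); let ω : ℂ :=
Complex.exp (2 * Real.pi * Complex.I / 3); ‖F s(v, w₀) + ω * F s(v, w₁) + ω ^ 2 * F s(v, w₂)‖ ≤ k *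
‖F s(v, w₀) + F s(v, w₁) + F s(v, w₂)‖) ∧ (∀ ε : ℝ, 0 < ε → ∃ R : ℝ, ∀ (Λ : Finset
Literature.Probability.LatticeModels.HexVertex),
Literature.Probability.RandomPlanarGeometry.SAW.hexDomainSimplyConnected Λ → ∀ a ∈
Literature.Probability.RandomPlanarGeometry.SAW.hexDomainBoundary Λ, ∀ v ∈ Λ, (∀ w :
Literature.Probability.LatticeModels.HexVertex, dist (Literature.Probability.LatticeModels.hexCenter
w) (Literature.Probability.LatticeModels.hexCenter v) ≤ R → w ∈ Λ) → ∀ w₀ w₁ w₂ :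
Literature.Probability.LatticeModels.HexVertex, Literature.Probability.LatticeModels.hexGraph.Adj v
w₀ → Literature.Probability.LatticeModels.hexGraph.Adj v w₁ →
Literature.Probability.LatticeModels.hexGraph.Adj v w₂ → w₀ ≠ w₁ → w₁ ≠ w₂ → w₀ ≠ w₂ → let F : Sym2
Literature.Probability.LatticeModels.HexVertex → ℂ :=
Literature.Probability.RandomPlanarGeometry.SAW.hexParafermionicObservable Λ a
Literature.Probability.RandomPlanarGeometry.SAW.hexCriticalFugacity (5 / 8); let ω : ℂ :=
Complex.exp (2 * Real.pi * Complex.I / 3); ‖F s(v, w₀) + ω * F s(v, w₁) + ω ^ 2 * F s(v, w₂)‖ ≤ ε *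
‖F s(v, w₀) + F s(v, w₁) + F s(v, w₂)‖) ∧ ((∃ k : ℝ, k < 1 ∧ ∀ (Λ : Finset
Literature.Probability.LatticeModels.HexVertex),
Literature.Probability.RandomPlanarGeometry.SAW.hexDomainSimplyConnected Λ → ∀ a ∈
Literature.Probability.RandomPlanarGeometry.SAW.hexDomainBoundary Λ, ∀ v ∈ Λ, ∀ w₀ w₁ w₂ :
Literature.Probability.LatticeModels.HexVertex, Literature.Probability.LatticeModels.hexGraph.Adj v
w₀ → Literature.Probability.LatticeModels.hexGraph.Adj v w₁ →
Literature.Probability.LatticeModels.hexGraph.Adj v w₂ → w₀ ≠ w₁ → w₁ ≠ w₂ → w₀ ≠ w₂ → let F : Sym2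
Literature.Probability.LatticeModels.HexVertex → ℂ :=
Literature.Probability.RandomPlanarGeometry.SAW.hexParafermionicObservable Λ a
Literature.Probability.RandomPlanarGeometry.SAW.hexCriticalFugacity (5 / 8); let ω : ℂ :=
Complex.exp (2 * Real.pi * Complex.I / 3); ‖F s(v, w₀) + ω * F s(v, w₁) + ω ^ 2 * F s(v, w₂)‖ ≤ k *
‖F s(v, w₀) + F s(v, w₁) + F s(v, w₂)‖) → (∀ ε : ℝ, 0 < ε → ∃ R : ℝ, ∀ (Λ : Finset
Literature.Probability.LatticeModels.HexVertex),
Literature.Probability.RandomPlanarGeometry.SAW.hexDomainSimplyConnected Λ → ∀ a ∈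
Literature.Probability.RandomPlanarGeometry.SAW.hexDomainBoundary Λ, ∀ v ∈ Λ, (∀ w :
Literature.Probability.LatticeModels.HexVertex, dist (Literature.Probability.LatticeModels.hexCenter
w) (Literature.Probability.LatticeModels.hexCenter v) ≤ R → w ∈ Λ) → ∀ w₀ w₁ w₂ :
Literature.Probability.LatticeModels.HexVertex, Literature.Probability.LatticeModels.hexGraph.Adj v
w₀ → Literature.Probability.LatticeModels.hexGraph.Adj v w₁ →
Literature.Probability.LatticeModels.hexGraph.Adj v w₂ → w₀ ≠ w₁ → w₁ ≠ w₂ → w₀ ≠ w₂ → let F : Sym2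
Literature.Probability.LatticeModels.HexVertex → ℂ :=
Literature.Probability.RandomPlanarGeometry.SAW.hexParafermionicObservable Λ a
Literature.Probability.RandomPlanarGeometry.SAW.hexCriticalFugacity (5 / 8); let ω : ℂ :=
Complex.exp (2 * Real.pi * Complex.I / 3); ‖F s(v, w₀) + ω * F s(v, w₁) + ω ^ 2 * F s(v, w₂)‖ ≤ ε *
‖F s(v, w₀) + F s(v, w₁) + F s(v, w₂)‖) → (∃ c : ℂ, c ≠ 0 ∧ ∀ (D :
Literature.Probability.RandomPlanarGeometry.DobrushinDomain) (ρ : ℝ) (Λ : ℝ → Finset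
Literature.Probability.LatticeModels.HexVertex) (m : Fin 2 → ℝ → ℤ) (a b : ℝ → Sym2
Literature.Probability.LatticeModels.HexVertex) (Φ :
Literature.Probability.RandomPlanarGeometry.ConformalEquiv D.carrier
UpperHalfPlane.upperHalfPlaneSet) (L : ℂ → ℂ) (Lb : ℂ) (ψ : ℂ → ℂ), let F : ℝ → Sym2
Literature.Probability.LatticeModels.HexVertex → ℂ := fun δ z =>
Literature.Probability.RandomPlanarGeometry.SAW.hexParafermionicObservable (Λ δ) (a δ)
Literature.Probability.RandomPlanarGeometry.SAW.hexCriticalFugacity (5 / 8) z; 0 < ρ → (∀ i : Fin 2,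
D.carrier ∩ Metric.ball (D.pt i) ρ = {z : ℂ | (D.pt i).im < z.im} ∩ Metric.ball (D.pt i) ρ) → (∀ᶠ δ
: ℝ in nhdsWithin 0 (Set.Ioi 0),
Literature.Probability.RandomPlanarGeometry.SAW.hexDomainSimplyConnected (Λ δ) ∧ a δ ∈
Literature.Probability.RandomPlanarGeometry.SAW.hexDomainBoundary (Λ δ) ∧ b δ ∈
Literature.Probability.RandomPlanarGeometry.SAW.hexDomainBoundary (Λ δ) ∧ Nonempty
(Literature.Probability.RandomPlanarGeometry.SAW.HexMidEdgeSAW (Λ δ) (a δ) (b δ)) ∧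
(Literature.Probability.LatticeModels.hexGraph.induce ((Λ δ : Finset
Literature.Probability.LatticeModels.HexVertex) : Set
Literature.Probability.LatticeModels.HexVertex)).Preconnected ∧ (∀ v ∈ Λ δ, (δ : ℂ) *
Literature.Probability.LatticeModels.hexCenter v ∈ D.carrier) ∧ (∀ i : Fin 2, ∀ v :
Literature.Probability.LatticeModels.HexVertex, (δ : ℂ) *
Literature.Probability.LatticeModels.hexCenter v ∈ Metric.ball (D.pt i) ρ → (v ∈ Λ δ ↔ m i δ ≤ v.1
1))) → (∀ K : Set ℂ, IsCompact K → K ⊆ D.carrier → ∀ᶠ δ : ℝ in nhdsWithin 0 (Set.Ioi 0), ∀ v :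
Literature.Probability.LatticeModels.HexVertex, (δ : ℂ) *
Literature.Probability.LatticeModels.hexCenter v ∈ K → v ∈ Λ δ) → Filter.Tendsto (fun δ : ℝ => (δ :
ℂ) * Literature.Probability.RandomPlanarGeometry.SAW.hexMidpoint (a δ)) (nhdsWithin 0 (Set.Ioi 0))
(nhds (D.pt 0)) → Filter.Tendsto (fun δ : ℝ => (δ : ℂ) *
Literature.Probability.RandomPlanarGeometry.SAW.hexMidpoint (b δ)) (nhdsWithin 0 (Set.Ioi 0)) (nhds
(D.pt 1)) → Filter.Tendsto (fun x => ‖Φ x‖) (nhdsWithin (D.pt 0) D.carrier) Filter.atTop →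
Φ.HasBoundaryValue (D.pt 1) 0 → ContinuousOn L D.carrier → (∀ z ∈ D.carrier, Complex.exp (L z) =
deriv Φ z) → Filter.Tendsto L (nhdsWithin (D.pt 1) D.carrier) (nhds Lb) → Continuous ψ →
HasCompactSupport ψ → tsupport ψ ⊆ D.carrier → Filter.Tendsto (fun δ : ℝ => (δ : ℂ) ^ 2 * (∑ᶠ e ∈
Literature.Probability.RandomPlanarGeometry.SAW.hexDomainMidEdges (Λ δ), ψ ((δ : ℂ) *
Literature.Probability.RandomPlanarGeometry.SAW.hexMidpoint e) * F δ e) / F δ (b δ)) (nhdsWithin 0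
(Set.Ioi 0)) (nhds (c * ∫ z, ψ z * Complex.exp ((5 / 8 : ℂ) * (L z - Lb))))))`

## Assembly
The deciding theorem `closes` (rev 13) binds the SIX CRUX items and nothing else — no support, no
assembly, neither waypoint:
`theorem closes : NoFoldBound → InteriorFlattening → QCIdentification → HexTight → ObservableToSLE →
HexTransfer → _root_.SAWScalingLimit :=
fun hK hM hId hT hObs hX => hX (hObs (hId hK hM) hT)` (pure logic; checked in the seat's Sketch.lean
against the rev-12 route file, rc 0;
axioms propext / Classical.choice / Quot.sound only). QCIdentification turns (K) + (M) into the
first waypoint HexObservableLimit;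
ObservableToSLE turns that waypoint + HexTight into DCS Conjecture 1 on the hexagonal lattice
(written out; its text is the waypoint item
HexConjecture ≡ Literature HexSAWScalingLimit, Iff.rfl); HexTransfer (≡ HexConjecture →
SAWScalingLimit, Iff.rfl) carries it to δℤ².
Neither waypoint is a hypothesis of `closes`: both are DERIVED (HexObservableLimit = hId hK hM;
HexConjecture's text = hObs (hId hK hM) hT)
and are items only because QCIdentification, ObservableToSLE and the landed ObservableToSLE/Negative
lemmas are stated over them by name; a
conjecture-grade item may be an item only as crux or target (rulings 2026-08-16), so the first
waypoint is the route's TARGET (#0) and the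
second a derived CRUX (#8). History of the glue: revs 0–8 `closes` over seven items with the single
glue HexToSquare; revs 9–12 over eight
binders including the routine supports HexEndpointApproxExists + SquareTransfer (stamped
glue.non-crux-hypothesis under the crux-only rule
of 2026-08-16 03:39Z); rev 13 (this route-choice) drops those two support binders and restates the
crux LatticeUniversality 1:1 into the one
shared tail crux HexTransfer — the crux-only fix the stamp names, with no prover debt left inside
`closes`.
Layer 1 (this route's mechanism) = NoFoldBound, InteriorFlattening, QCIdentification with the
provable-now supports PotentialExists and
SourceLoopBound; layer 2 (shared hexagonal pipeline, items deduplicated with SAWResidueField /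
SAWDefectDecoherence / SAWPhaseRetrieval /
SAWWindingAlias / SAWHexUniversality) = HexObservableLimit (target), HexTight, ObservableToSLE,
HexTransfer, HexConjecture (cruxes).
The Assembly ITEM (restated at rev 13 because its rev-7 form stmt-CriticalPhenomena-14071 named the
replaced LatticeUniversality) is the
non-glue frame statement NoFoldBound → InteriorFlattening → HexTight → HexTransfer → SAWScalingLimit
('the two estimates, tightness and the
tail suffice'), proved exactly by the two glue cruxes once they land (`fun hK hM hT hX => hX
(ObservableToSLE_holds (QCIdentification_holds
hK hM) hT)`, term checked in Sketch.lean); the rev-0 seven-item form (stmt-CriticalPhenomena-8301)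
was the type of the old `closes` and was
flagged ground.trivial, hence a frame statement rather than the glue chain; `closes` does not take
the Assembly item as a hypothesis.

Rationale: WHY THIS LINE. DCS Lemma 1 (PROVED: DuminilCopinSmirnov2012_lemma1_holds) is Kirchhoff's node law
for the edge flow ω(v→v′) = (p − v)F(p), so on a simply connected domain F = dH for a complex
potential H on the hexagon centres (the sites of 𝕋); reading H as a PIECEWISE-LINEAR MAP of the
triangulation (one triangle Δ_v per vertex v), the three mid-edge values around v are the
ℤ/3-Fourier data of the affine map H|Δ_v (sum = 6i√3·∂H, DCS combination = 0, remaining mode =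
−6i√3(ē₀/e₀)·∂̄H, Jacobian = (|F̂₀|² − |F̂₂|²)/108), so the "missing half of discrete
Cauchy–Riemann" (barrier ParafermionicHalfCauchyRiemann: one kernel element per hexagon = the
freedom of H) becomes a number per vertex, the Beltrami coefficient μ_v, and a fold of the map is
|μ_v| ≥ 1.
The line transplants the circle-packing convergence scheme (RodinSullivan1987, HeSchramm1996) with
an explicit dictionary — Ring Lemma ↦ (K) uniform no-fold bound, hexagonal rigidity ↦ (M) bulk
flattening, packing map ↦ developing map H_δ, Riemann map ↦ h = ∫(φ′)^(5/8), normality / good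
approximation of K-quasiconformal maps (AstalaIwaniecMartin2008 Thm 3.9.4, Lemma 5.3.5;
LehtoVirtanen1973) ↦ the a-priori compactness DCS lack, Tutte–Floater injectivity (Floater2002,
GortlerGotsmanThurston2006) ↦ H_δ is a homeomorphism — and identifies the limit by a Riemann–Hilbert
/ Schwarz–Christoffel rigidity driven by DCS's EXACT boundary winding (arXiv:1007.0575 p. 7: the
image polygon Π_δ = H_δ(∂) has edge directions (3/8)θ_ν(p) + const), with the Kennedy–Lawler
boundary factors (KennedyLawler2013) as the named obstruction on general staircase boundaries.
Imported areas: quasiconformal mappings and discrete conformal geometry (PL maps, circle packings;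
the Ising/dimer precedent of observable-built embeddings arXiv:2001.11871, arXiv:2006.14559,
arXiv:2512.20361), plus the SAW's exact renewal structure: at every vertex the triple (F(p_i))_i is
a superposition over first arrivals γ of SOURCE triples in the slit domains Λ∖γ, reducing (K) to a
critical rooted-polygon inequality (SourceLoopBound) plus phase coherence of first-arrival
amplitudes, and (M) to port equalisation.
What prior routes and the negatives index do not do: SAWParafermion (BROKEN on the refuted all-δ
tightness stmt-0772, not used here) and SAWHexUniversality keep Conjecture 2 / 1 as one undecomposed
crux; SAWResidueField (same object) splits F = G* + P by ℓ²-projection and needs the residue ENERGY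
to vanish plus strong L² boundary covariance; here F stays whole as dH, the defect is a pointwise
dilatation obeying a lattice inequality that holds exactly where F is far from holomorphic (|μ| up
to 0.68), compactness comes from (K) alone, and on zigzag-polygonal domains the boundary problem
needs no length data at all.

RANKED CRUXES. Since rev 13: ONE TARGET (#0 HexObservableLimit, the first derived waypoint) + SEVEN
CRUXES (= cap): #2–#4 are the line ((K) NoFoldBound, (M) InteriorFlattening, (Id) QCIdentification),
#5–#7 the shared hexagonal pipeline (HexTight, ObservableToSLE, HexTransfer), #8 HexConjecture the
second DERIVED WAYPOINT (kept as a crux: conjecture-grade by name and statement, decl named by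
landed Theorems files, single-target convention); `closes` binds exactly the six cruxes #2–#7 and
assumes neither waypoint. History (NUMBERS, 'Items'): rev 13 (this route-choice) applies the
crux-only rule for `closes` — the tail crux LatticeUniversality (0807) is restated 1:1 into the
shared tail crux HexTransfer (14221) and the routine supports HexEndpointApproxExists (9864) +
SquareTransfer (14521) leave THIS route (all three items stay with their sibling routes), so no
support is a hypothesis of `closes`. Seven is the cap ('consider whether this is two theses'): it is
not — layer 2 is the pipeline every hexagonal line must carry to reach the δℤ² Statement (a
layer-1-only route would conclude Conjecture 2, not SAWScalingLimit: not-a-thesis, D-0027), shared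
by five sibling routes, not a separable thesis.
#0 HexObservableLimit (TARGET, rank 0 — the first waypoint, DERIVED inside `closes` as
QCIdentification hK hM and consumed by ObservableToSLE; shared item stmt-CriticalPhenomena-14003,
carried as HexObservableLimitR by SAWDefectDecoherence / SAWResidueField / SAWPhaseRetrieval /
SAWWindingAlias, whose own cruxes attack it) — DCS 2012 Conjecture 2 on the hexagonal lattice, typed
and ψ-averaged, REPAIRED at rev 4 (stmt-5420 refuted-misstated by
SAWDefectDecoherenceHexObservableLimit_refuted — a boundary-hugging corridor with a moat relocates
the conformal root — and kept in the file as a negative edge): ∃ c ≠ 0 universal with δ²⟨ψ,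
F_δ⟩/F_δ(b_δ) → c ∫ ψ exp((5/8)(L − L_b)) for every Dobrushin domain flat in the ρ-balls at a AND b
and every admissible discretisation family with exact half-lattice rows in both balls (φ : Ω → ℍ, a
↦ ∞, b ↦ 0, L = log φ′, ψ ∈ C_c(Ω)); decl name unchanged (QCIdentification, ObservableToSLE and the
landed ObservableToSLE/Negative lemmas are stated over it). (why it might fail: open since 2010;
fails if subsequential limits keep a dz̄-part (¬M) or if collar decorations away from a, b shift
⟨ψ,F⟩/F(b) at leading order; reached here only through (K)+(M)+(Id), each breakable; c is universal
only for the rigid zigzag class, built in at a and b.) [DuminilCopinSmirnov2012, arXiv:1007.0575,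
Smirnov2007ICM, KennedyLawler2013,
Summit.CriticalPhenomena.SAWScalingLimit.Theorems.SAWDefectDecoherenceHexObservableLimit_refuted]
#2 NoFoldBound (crux) — (K), card item K1, "the parafermion never folds, uniformly": one k < 1 with
‖F{v,w₀} + ωF{v,w₁} + ω²F{v,w₂}‖ ≤ k·‖ΣF‖ at every vertex of every simply connected hexagonal
domain, every boundary source, every labelling (one orientation class is 0 by Lemma 1, the other is
the Beltrami mode: |μ_v| ≤ k, i.e. H_δ is K-quasiconformal, K = (1+k)/(1−k)). [difficulty:
open-problem] (why it might fail: Coherent cancellation: a pocket fed through a two-edge mouth or a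
double spiral superposes first-arrival amplitudes with relative phases quantised in 22.5° steps and
can starve the monopole Σ(α_T−√3L_γ)c_γ while the Beltrami mode survives; evidence: polyhexes ≤ 8
cells + 14 shapes, max 0.68; refuter enumeration sup ≥ 0.686 at the root.) [DuminilCopinSmirnov2012,
Floater2002, GortlerGotsmanThurston2006, RodinSullivan1987,
Summits/CriticalPhenomena/SAWScalingLimit/Ideas/parafermion-developing-map-no-folds.md]
#3 InteriorFlattening (crux) — (M), card item K2, bulk flattening, pointwise and uniform: for every
ε > 0 an R such that the same Beltrami quotient is ≤ ε at every vertex whose Euclidean R-ball of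
lattice vertices lies in Λ, uniformly in (Λ, a) — the three mid-edge values around a deep vertex
equalise (DCS p. 7: "the same limit regardless of the orientation of the edge"). [difficulty:
open-problem] (why it might fail: This IS DCS's curl-vanishing, localised: for σ=1/2 (FK-Ising) the
analogue is false on the lattice (edge values are projections of one value onto lines,
arXiv:0910.2045 §2.2), so it hinges on decoherence of the 5/8-phases; exact data reach depth 4 only
(|μ|≈0.1–0.3 there).) [DuminilCopinSmirnov2012, arXiv:1007.0575, DuminilCopin2013Parafermion,
arXiv:0910.2045, ChelkakSmirnov2012Ising,
Literature.Barriers.CriticalPhenomena.ParafermionicHalfCauchyRiemann]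
#4 QCIdentification (crux) — (Id), card item K3, compactness-and-identification: (K) and (M) imply
HexObservableLimit. Scheme: (K) ⇒ the normalised maps H_δ/F_δ(b_δ) are a uniformly K-qc family of PL
homeomorphisms onto simple polygons Π_δ (normal family, equi-Hölder); (M) ⇒ subsequential limits
conformal in Ω; the exact boundary winding gives Π_δ the edge-direction law (3/8)θ_ν(p) + (5/8)θ(a),
so for zigzag-polygonal Ω Schwarz–Christoffel forces h′ = c(φ′)^(5/8) with NO length data; general
Jordan Ω by boundary-factor balance or approximation; F_δ is read off dH_δ in the ψ-averaged sense.
[deps: NoFoldBound, InteriorFlattening, PotentialExists] [difficulty: XL] (why it might fail: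
Boundary: the exact per-edge direction law mixes edge types on a staircase boundary with
Kennedy–Lawler length factors, so lim Π_δ has the (3/8)θ tangent law only if Σ n_iℓ_i
sin((3/8)(θ_i−θ_n)) = 0 per slope; zigzag-polygonal Ω are rigid, general Jordan Ω and the pole at a
are not.) [KennedyLawler2013, RodinSullivan1987, HeSchramm1996, AstalaIwaniecMartin2008,
LehtoVirtanen1973, Pommerenke1992, DuminilCopinSmirnov2012, arXiv:2512.20361]
#5 HexTight (crux; shared item stmt-CriticalPhenomena-5423) — eventual tightness of the critical
hexagonal SAW laws: for every Dobrushin domain and hexagonal endpoint approximation the family δ ↦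
hexSAWLaw pushed to CurveClass ℂ is tight along 𝓝[>]0 (IsTightAlongMesh — NOT the refuted all-δ
IsTightLaws form of stmt-0772). Here (K) offers a new handle: quasisymmetry of H_δ gives two-sided
control of mesoscopic parafermionic masses, a candidate substitute for RSW. (why it might fail: No
RSW/annulus-crossing technology for SAW (n = 0: no FKG; KS17 §4 covers FK, percolation, harmonic
explorer, LERW; G2 fails for UST §4.5); strongest inputs: sub-ballisticity (DCH13,
arXiv:2310.17299). Eventual form avoids refuted all-δ item 0772.) [KemppainenSmirnov2017,
DuminilCopinHammond2013, arXiv:2310.17299, arXiv:1212.6215,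
Summit.CriticalPhenomena.SAWScalingLimit.Theorems.SAWParafermionTight_refuted]
#6 ObservableToSLE (crux; stmt-CriticalPhenomena-10472, the staffed crux with lines and a lead) —
the martingale-observable identification: HexObservableLimit → HexTight → [DCS 2012 Conjecture 1
written out ≡ item HexConjecture ≡ Literature HexSAWScalingLimit, Iff.rfl]: the b-normalised
observable is an exact discrete martingale, its limit forces the driving process of every
subsequential limit to be √(8/3)B (LSW03 Prop. 5.2), and tightness + uniqueness of the SLE law
conclude (SLEConvergenceCriterion). [deps: HexObservableLimit, HexTight] [difficulty: XL] (why it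
might fail: The martingale ⟨ψ,F_Ωn⟩/F_Ωn(b) needs the observable limit in the SAW's own slit
domains, uniformly (Carathéodory), and rough b; HexObservableLimit is per fixed Jordan domain, flat
at b. Projective data fix κ = 8/3 but not the drift, so the b-normalisation is load-bearing.)
[LawlerSchrammWerner2003, KemppainenSmirnov2017, DuminilCopinSmirnov2012Clay, Smirnov2007ICM,
DuminilCopinSmirnov2012, arXiv:math/0209343]
#7 HexTransfer (crux; shared item stmt-CriticalPhenomena-14221, crux in SAWPhaseRetrieval /
SAWWindingAlias, refuter-vetted twice 'survives', flagged restates-target = planner-declared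
conjecture-grade tail) — LATTICE-UNIVERSALITY TRANSFER: DCS 2012 Conjecture 1 written out (verbatim
the conclusion of ObservableToSLE and the text of HexConjecture) IMPLIES the δℤ² Statement
SAWScalingLimit (≡ HexConjecture → SAWScalingLimit, Iff.rfl). Weaker than the asymptotic equality of
laws LatticeUniversality (stmt-0807, the rev ≤ 12 tail of this route, still the rank-2 crux of
SAWHexUniversality) and implied by it: hexTransfer_of : HexEndpointApproxExists →
LatticeUniversality → HexTransfer (two-ε gluing + AEMeasurable from the discrete σ-algebra;
sorry-free in the refuter evidence Reduction.lean on 14221) — the foreseen glued split (TWO-LAYER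
PLAN). This route reaches δℤ² only through it (no vertex relation exists on ℤ²:
not_hasExactVertexRelationZ2). [deps: ObservableToSLE, HexTight] [difficulty: open-problem] (why it
might fail: open content = lattice universality ℤ² vs Hex of the critical SAW law: uniform ℤ² SAW
lies in no Yang–Baxter/integrable family (GM19 p.1; barrier NienhuisWeightsExcludeVertexSAW), so no
transfer tool exists even given the hexagonal SLE(8/3) limit; Kennedy–Lawler boundary lattice
effects could split ℤ² endpoint classes; ¬HexTransfer ⇔ Conj. 1 ∧ ¬Statement.)
[GlazmanManolescu2019, KennedyLawler2013, DuminilCopinSmirnov2012, LawlerSchrammWerner2004SAW,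
Literature.Barriers.CriticalPhenomena.NienhuisWeightsExcludeVertexSAW,
Literature.Barriers.CriticalPhenomena.not_hasExactVertexRelationZ2]
#8 HexConjecture (crux, rank 9 as filed; shared item stmt-CriticalPhenomena-0808, crux rank 2/3 in
SAWBrickWallHomotopy / SAWHexUniversality, where it is attacked directly with a standing disprover
(Cruxes/HexConjecture/Disproof.lean); ≡ Literature HexSAWScalingLimit, Iff.rfl) — DCS 2012
Conjecture 1 verbatim (critical hexagonal SAW ⇒ chordal SLE(8/3) for every Dobrushin domain and
hexagonal endpoint approximation). The SECOND WAYPOINT: not a hypothesis of `closes`, derived here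
as ObservableToSLE (QCIdentification hK hM) hT; it stays an item because three landed Theorems
modules (ObservableToSLE/Negative/{EndpointNecessity, TightnessNecessity, ChordalCarrier}) and the
standing Disproof work files of ObservableToSLE / ObservableToSLER / HexConjecture name
`SAWDevelopingMap.HexConjecture` (dropping it would break landed negatives), and it stays a CRUX
rather than a second target because it is conjecture-grade by name and statement and the route keeps
one target (= the thesis' first deliverable). (why it might fail: open since 2010: needs tightness
of the critical hexagonal SAW (no RSW/FKG at n = 0) AND identification of subsequential limits; the
parafermion obeys only half of discrete CR (barrier ParafermionicHalfCauchyRiemann); closes here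
only via HexObservableLimit + HexTight + ObservableToSLE, each breakable.) [DuminilCopinSmirnov2012,
arXiv:1007.0575, LawlerSchrammWerner2004SAW, arXiv:2310.17299,
Literature.Barriers.CriticalPhenomena.ParafermionicHalfCauchyRiemann]
#9 PotentialExists (support) — the potential lemma F = dH on the hexagon centres (closedness = Lemma
1, proved; exactness = discrete Poincaré lemma on the simply connected triangle complex); statement
in the item docstring. [difficulty: M] [DuminilCopinSmirnov2012,
Literature.Probability.RandomPlanarGeometry.SAW.DuminilCopinSmirnov2012_lemma1,
GortlerGotsmanThurston2006]
#9 SourceLoopBound (support) — the source-vertex half of (K) as a critical rooted-polygon inequality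
Z_{Λ∖v}({v,w₁}→{v,w₂}; x_c) ≤ c < sin(π/8) = 0.3827 (fold at the source ⇔ Z ≥ sin(π/8); observed Z ≤
0.081, smallest loop x_c^5 = 0.046); statement in the item docstring. [difficulty: L]
[DuminilCopinSmirnov2012, MadrasSlade1993, BeatonBousquetMelouDeGierDuminilCopinGuttmann2014]
(Gone from this route at rev 13, alive in the sibling routes: LatticeUniversality 0807 (restated
here into HexTransfer), HexEndpointApproxExists 9864 and SquareTransfer 14521 (dropped) — together
they prove HexTransfer in one line, `fun hC => hSq hE hC hU`, Sketch.lean rc 0.)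

TWO-LAYER PLAN. Shape since rev 13: 1 target (HexObservableLimit) / 7 cruxes / 2 supports / 1
assembly = 11 items, all depth 0; `closes` binds the six cruxes NoFoldBound, InteriorFlattening,
QCIdentification, HexTight, ObservableToSLE, HexTransfer (no glue debt: the rev-9–12 support binders
HexEndpointApproxExists + SquareTransfer are dropped and the crux LatticeUniversality is restated
1:1 into the shared tail crux HexTransfer). The re-layering recorded at rev 9 (`route edit --split
HexObservableLimit --into NoFoldBound InteriorFlattening --glue-decl-name QCIdentification`) is not
needed for the cap and is left to the tenure planner. No honest second thesis exists to split off: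
layer 2 is the shared pipeline of five routes, not a line.
Foreseen glued splits once a crux moves (k ≤ 3, depth 1; nothing filed now):
NoFoldBound ⇐ PortDecomposition (exact renewal identity: the triple at any v is Σ over first
arrivals γ at port i(γ) of c_γ times the SOURCE triple of the slit domain Λ∖γ — provable now, the
glue) → SourceLoopBound (every source triple has ratio ≤ r < 1; filed as support) →
FirstArrivalCoherence (|Σ_γ (α_T−√3L_γ)c_γ| ≥ r′ |Σ_γ ρ^(i(γ))(β_T+√3L_γ)c_γ|: no destructive
interference of first-arrival amplitudes across the three ports) → NoFoldBound.
InteriorFlattening ⇐ PortEqualisation (T₀ − T₁, T₀ − T₂ = o(|T₀|) for the three first-arrival port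
sums at depth R, uniformly) → LoopTailUniform (L_γ-fluctuations average out at depth R) →
InteriorFlattening.
QCIdentification ⇐ QCCompactness ((K) ⇒ normalised H_δ precompact, limits K-qc homeomorphisms or
constants, non-degenerate by the DCS boundary sum rule; (M) ⇒ limits conformal inside) →
PolygonalRigidity (zigzag-polygonal Dobrushin domains: straight image sides of directions (3/8)θ_ν +
c, corner correspondence, Schwarz–Christoffel ⇒ h′ = c(φ′)^(5/8)) → BoundaryBalance (general Jordan
Ω: per boundary slope the Kennedy–Lawler factors of the edge types obey Σ_i n_i ℓ_i sin((3/8)(θ_i −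
θ_n)) = 0 — automatic for zigzag sides, by reflection + ratio-limit for armchair sides — or an
interior approximation argument replacing it) → QCIdentification.
ObservableToSLE ⇐ SlitUniformObservable → LoewnerRegularity → ObservableToSLE (shared with
SAWResidueField's plan).
HexTransfer ⇐ HexEndpointApproxExists (support, = stmt-9864: hexagonal endpoint approximations
exist, the hex port of MeshDomainBulk / MeshDomainJordan behind SAW.exists_isEndpointApprox;
provable now) → LatticeUniversality (crux, = stmt-0807) → HexTransfer, glue = hexTransfer_of of the
refuter's Reduction.lean on stmt-14221 (sorry-free; file it with `--split HexTransfer --into …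
--glue-by <landed decl>` once a prover lands it under Theorems with --supports
stmt-CriticalPhenomena-14221); the children deduplicate with the sibling routes' items, so nothing
new is staffed.

KILL CRITERIA. A certified fold — one simply connected Λ, one boundary source a, one vertex v with
‖F(p₀)+ωF(p₁)+ω²F(p₂)‖ ≥ ‖ΣF(p_k)‖ in the non-DCS orientation at (x_c, 5/8), in exact arithmetic
over ℚ(x_c, ζ₄₈) — refutes NoFoldBound as filed. If the witness lives in the bulk of a fat domain or
recurs at all scales: `close --reason refuted:NoFoldBound` (the developing map is not a
homeomorphism, compactness is gone, the card's mechanism is dead). If it is confined to width-one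
fjords or two-edge pocket mouths: pivot (restate (K) at lattice distance ≥ R₀ from ∂Λ — all
QCCompactness needs — and move the boundary layer into QCIdentification). Z ≥ sin(π/8) for some
domain (¬SourceLoopBound) is a fold at the source vertex — same verdict. ¬InteriorFlattening with a
family |μ(v_R)| ≥ ε₀ at all depths R refutes the orientation independence DCS expect and with it
HexObservableLimit for every route: close `refuted:InteriorFlattening` and hand the witness to the
sibling routes as negative knowledge. ¬QCIdentification with (K), (M) standing can only come from
the boundary (BoundaryBalance failing for some slope, i.e. a lattice-dependent tangent law of lim
Π_δ): pivot to the zigzag-polygonal target and an interior normalisation; a measured violation of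
BoundaryBalance is evidence against Conj. 2 on mixed-slope domains and is reported as such.
¬HexTight, ¬HexConjecture, ¬HexTransfer are conjunct-level events shared with the sibling routes
(¬HexTight ⇒ ¬HexConjecture is landed: not_hexConjecture_of_not_hexTight; ¬HexTransfer ⇔
HexConjecture ∧ ¬SAWScalingLimit, i.e. a genuine failure of lattice universality — it decides the
summit conjunct negatively and closes every hexagonal route; a refutation of the stronger
LatticeUniversality (0807) in a sibling route does NOT by itself touch HexTransfer). HexConjecture
or HexObservableLimit proved elsewhere moots layer 1 (and closes the waypoint items here);
SAWScalingLimit proved directly on ℤ² moots everything. A SECOND refutation of the repaired first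
waypoint (stmt-14003) by a witness that respects the rigid ρ-balls at a and b (collar decorations,
thin pockets) does not touch (K), (M): restate to the canonical-discretisation form
(stmt-CriticalPhenomena-14009 of SAWPhaseRetrieval) or file the Carathéodory-convergence definition
and restate over it.

NOT DECOMPOSED YET. The exact port / first-arrival decomposition and the source law (finite
identities, provers attach them with `--supports NoFoldBound`); the discrete Poincaré lemma inside
PotentialExists; the Floater/degree step ((K) + Π_δ simple ⇒ H_δ injective) and simplicity or
convexity of Π_δ; every normalisation (b on the flat zigzag piece is inherited from
HexObservableLimit; the π/4-sector end of the image at h(a) = ∞; interior vs boundary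
normalisation); the Carathéodory-uniform slit-domain version needed inside ObservableToSLE; the
recovery of point values of F_δ from dH_δ (the waypoint is ψ-averaged, so weak convergence of ∂H_δ
suffices); the certified small-case enumeration of (K) (a kit job and an evidence file, not an
item); all constants (k, K = (1+k)/(1−k), the Hölder exponent 1/K, R(ε)). All are layer-2 children
or prover lemmas, later (D-0019).

CHEAPEST FALSIFIER. Exact fold search beyond the card's run (33 049 polyhex cases ≤ 8 cells × all
sources + 14 shapes to 97 vertices: 0 folds, max |μ| = 0.6776 at the source vertex, 0.6145
elsewhere): (i) all simply connected VERTEX domains (connected complement, not only polyhexes) with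
≤ 14 vertices × all boundary sources; (ii) pockets fed through a two-edge mouth — superpose two
coherent sources with the relative phases realisable by winding classes and maximise |μ| inside; one
vertex with the Beltrami mode ≥ the sum kills NoFoldBound as filed. (iii) Transfer-matrix evaluation
of Z = Σ x_c^ℓ over walks q → r avoiding v in strips/balls of radius ≤ 10 around the source: Z ≥
0.3827 anywhere kills SourceLoopBound (observed ≤ 0.081). (iv) For (Id): estimate the two armchair
boundary factors ℓ₁, ℓ₂ of |F_δ(p)| on a 60°-rotated flat boundary far from a; ℓ₁ ≠ ℓ₂ beyond error
kills BoundaryBalance for the simplest mixed case. (Card code paths: scratch/polyhex_search.py,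
hexpara.py, sawenum.c; refuter evidence NOFOLD_NUMERICS.md on stmt-8296: no fold found, sup ≥ 0.686
at the root.)

NUMBERS. σ = 5/8, x_c = 1/√(2+√2) = 0.541196 (2x_c cos(π/8) = 1; DCS Thm 1, Lemma 1 PROVED in the
tree); ω = e^(2πi/3). Source triple (1, x_c e^(∓i·37.5°) + L e^(∓i·150°)), L = x_c Z; α_T = 1 + 2x_c
cos(5π/24) = 1.85872, β_T = 1 + 2x_c cos(11π/24) = 1.14128; |μ(source)| = (β_T + √3L)/(α_T − √3L);
fold iff L ≥ (α_T − β_T)/(2√3) = x_c sin(π/8) = 0.207107 iff Z ≥ sin(π/8) = 0.382683; one-hexagon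
loop Z ≥ x_c^5 = 0.04643, observed Z ≤ 0.081 (margin ×4.7, card); corridor value |μ| = β_T/α_T =
0.61402, observed max off-source 0.6145, global max 0.6776 ⇒ K ≈ 5.2 (card: 33 049 exact cases + 14
domains to 97 vertices); controls (card): holed domains fold (|μ| to 2.757), x ≥ 0.75 folds.
Honeycomb edge 1/√3 in triEmbed units. Image polygon: edge directions (3/8)θ_ν(p) + (5/8)θ(a),
exterior angles 3/8 of Ω's, interior angles π(5/8 + (3/8)α_j), end of opening π/4 at h(a) = ∞;
boundary scaling F_δ(b_δ) ~ δ^(5/4); the polygon closes: Σ_(p∈∂∖a)(p − v)F(p) = −(a − v₁); κ = 8/3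
from (5/8, −5/4).
Items: 11 at open; 12 at rev 2; rev 4 restated the target (5420 → 14003); rev 7 the Assembly item
(8301 → 14071); revs 9–10 (route-choice gen 0, hold 2026-08-16T02:41Z '3 conjecture-grade non-crux
items would make 9 cruxes > cap 7'): HexToSquare (10473) dropped, routine supports
HexEndpointApproxExists + SquareTransfer added as `closes` binders, both waypoints re-badged crux (8
cruxes); rev 11 (gen 2): HexObservableLimit crux → TARGET (7 cruxes); rev 13 (crux-only rule for
`closes`, stamp glue.non-crux-hypothesis 04:09Z): LatticeUniversality (0807) restated 1:1 →
HexTransfer (= 14221, shared), − HexEndpointApproxExists (9864), − SquareTransfer (14521) from this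
route, Assembly restated (14071 → the HexTransfer frame), `closes` over the six cruxes. Since rev
13: 11 items = 1 target + 7 cruxes + 2 supports + 1 assembly; 0 conjecture-grade non-crux items
besides the target; 0 non-crux `closes` binders; the three items named by the 02:41Z hold record are
settled (HexToSquare dropped, HexConjecture crux, HexObservableLimit target — refuter-vetted, never
auto-promoted per the gate ruling 2026-08-16 03:1xZ).

DEFINITION REQUESTS. None: every statement is over existing declarations of HexParafermion.lean,
HexSAW.lean, TriangularLattice.lean and the shared pipeline decls (DobrushinDomain, ConformalEquiv,
IsTightAlongMesh, IsEmbEndpointApprox, ConvergesInLawToSLE), all `lean search`-verified; Sketch.lean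
elaborates (rc 0). Optional, not filed: `hexParafermionPotential Λ a : Site 2 → ℂ` (the H of
PotentialExists) and `hexBeltramiMode Λ a v`; a Literature lemma `SAW.exists_isEmbEndpointApprox`
(would discharge the HexEndpointApproxExists child of the foreseen HexTransfer split); a
Carathéodory-convergence notion for marked discrete domains only if the first waypoint needs a
second repair (KILL CRITERIA).

Novelty: Searches (2026-08-15): `lit search --hybrid "parafermionic observable self-avoiding walk
quasiconformal Beltrami piecewise linear map injective"` (12 book rows: Lawler,
Astala–Iwaniec–Martin, Lehto, Lehto–Virtanen — the qc toolkit, no SAW-observable map); `lit search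
--source zbmath "parafermionic observable quasiconformal OR developing map OR Beltrami coefficient
self-avoiding walk"` (0); zbMATH "Chelkak s-embeddings Ising" (7: arXiv:2006.14559,
arXiv:2309.08470, arXiv:2512.20361, Affolter–Dellinger–Müller Lorentz s-embeddings arXiv:2410.11575,
cube moves arXiv:2003.08941); zbMATH "dimer model holomorphic functions t-embeddings" (1:
arXiv:2001.11871); `lit galaxy search "parafermionic observable" --star all` (7:
doi:10.21711/217504322013/em251, DC–Manolescu fractal FK, arXiv:2409.03235 bond-percolation half-CR
claim, Dewan–Muirhead); `lit galaxy search "convex combination map" --star all` (Floater–Hormann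
survey, "27 variants of Tutte's theorem" — PL injectivity, no probability); `lit vsearch` on the
mechanism sentence (discrete conformal geometry textbooks only); `lit frontier CriticalPhenomena
--since 2021` (30 rows; SAW-relevant only arXiv:2310.17299); reads: arXiv:1007.0575 p. 7 (L63–66
curl / orientation remark, RH BVP, Conjecture 2), arXiv:0910.2045 §2.2 (FK-Ising edge values are
projections onto lines — the σ = 1/2 contrast for (M)); all 30 sibling Theses files grepped for
beltrami|quasiconformal|fold|piecewise (incidental mentions only); OpenAlex and arXiv APIs rate-  [refs: 10.21711/217504322013/em251, 2006.14559, 2309.08470, 2512.20361, 2410.11575, 2003.08941, 2001.11871, 2409.03235, 2310.17299, 1007.0575, 0910.2045, doi:10.21711/217504322013/em251, RodinSullivan1987, HeSchramm1996, DuminilCopinSmirnov2012, Floater2002, GortlerGotsmanThurston2006]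

Barriers (technique_class: qc-developing-map pl-injectivity normal-families): - technique_class: qc-developing-map pl-injectivity normal-families
- Literature.Barriers.CriticalPhenomena.ParafermionicHalfCauchyRiemann: APPLIES to the object and is
the starting point — its kernel (HexKernel.witness, one ℂ per full hexagon, PROVED _holds) is
exactly the freedom of the potential H; EVADED in statement: nothing here reconstructs F_δ from
vertex relations + boundary values (the barrier's class) — the relations are used only as closedness
(PotentialExists), and determination is replaced by an inequality (K), a limit statement (M) and qc
compactness + boundary rigidity (Id); honest: (M) is the barrier's "other half in the scaling limit"
localised, and if it fails the barrier wins in the strong sense.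
- Literature.Barriers.CriticalPhenomena.FKParafermionicHalfCauchyRiemann: same structure for the FK
parafermion (q ≠ 2); the developing-map reading applies verbatim there (a by-product test-bed at q =
1, σ = 1/3), not an evasion claim.
- Literature.Barriers.CriticalPhenomena.NienhuisWeightsExcludeVertexSAW: respected (with
not_hasExactVertexRelationZ2) — no identity is written on ℤ²; the route lives on Hex and reaches the
conjunct only through LatticeUniversality.
- Literature.Barriers.CriticalPhenomena.SmirnovTriangularOnly: the mechanism is embedding-sensitive
in the right way — on a sheared honeycomb Lemma 1 holds with sheared coefficients, H is the sheared
map and μ does not flatten (limit = linear image); nothing embedding-blind is claimed.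
- Literature.Barri

History (route lifecycle, newest last):
- 2026-08-15T23:46:18Z · BROKEN — HexObservableLimit (stmt-CriticalPhenomena-5420, target) refuted by Summit.CriticalPhenomena.SAWScalingLimit.Theorems.SAWDefectDecoherenceHexObservableLimit_refuted @ b90fe791a4c9 (refuter-cdisprove-stmt-CriticalPhenomena-8536-0)
- 2026-08-16T00:03:57Z · rev 4: restated HexObservableLimit (stmt-CriticalPhenomena-5420 refuted) — repair (rev 4): target HexObservableLimit (stmt-5420) refuted-MISSTATED by SAWDefectDecoherenceHexObservableLimit_refuted @b90fe791 (boundary corridor + moat re (planner-rfix-CriticalPhenomena-SAWDeveloping-dd9ba4f2-0)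
- 2026-08-16T00:03:57Z · REPAIRED (restate HexObservableLimit) — back to open: repair (rev 4): target HexObservableLimit (stmt-5420) refuted-MISSTATED by SAWDefectDecoherenceHexObservableLimit_refuted @b90fe791 (boundary corridor + moat re (planner-rfix-CriticalPhenomena-SAWDeveloping-dd9ba4f2-0)
- 2026-08-16T00:14:53Z · rev 7: restated Assembly (stmt-CriticalPhenomena-8301) — route-repair (ground-failed, rground dd9ba4f2): the ONLY ground flag (payload.ground 2026-08-16T00:04:15Z; skipped []) is Assembly (stmt-CriticalPhenomena-8301, (planner-rground-CriticalPhenomena-SAWDeveloping-dd9ba4f2-0)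
- 2026-08-16T03:30:21Z · rev 9: dropped HexToSquare — route-choice (hold 2026-08-16T02:41Z smuggled-conjecture; option (a) drop items): HexToSquare (10473, no external references) dropped from this route (it stays (planner-rchoice-CriticalPhenomena-SAWDevelopin-5071444f-0)
- 2026-08-16T05:45:31Z · rev 13: restated LatticeUniversality (stmt-CriticalPhenomena-0807), Assembly (stmt-CriticalPhenomena-14071) — route-choice (repair-loop, base 2b584797): option (b) — apply exactly the fix named by the glue.non-crux-hypothesis stamp (04:09Z): `closes` becomes crux-only w (planner-rchoice-CriticalPhenomena-SAWDevelopin-2b584797-0)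
- 2026-08-16T05:45:31Z · rev 13: dropped HexEndpointApproxExists, SquareTransfer — route-choice (repair-loop, base 2b584797): option (b) — apply exactly the fix named by the glue.non-crux-hypothesis stamp (04:09Z): `closes` becomes crux-only w (planner-rchoice-CriticalPhenomena-SAWDevelopin-2b584797-0)
- 2026-08-26T05:04:15Z · DORMANT — reconciler: no traction for 8.4 d (last activity item-evidence-added at 2026-08-17T19:39:23Z); parked, not closed — `ledger route dormant route-CriticalPhenomen (operator:999:1916569)

sub-problem: SAWScalingLimit · status: dormant · opened planner-plancard-CriticalPhenomena-SAWScaling-daa3b32a-0 2026-08-15T12:37:41Z · rev 14 · ledger route-CriticalPhenomena-SAWDevelopingMap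
GENERATED by the gate from the ledger (D-0016/17). Provers cite these decls: `theorem foo : Summit.CriticalPhenomena.SAWScalingLimit.Theses.SAWDevelopingMap.<Decl> := …` in Summits/CriticalPhenomena/SAWScalingLimit/Theorems/<Name>.lean.
-/

namespace Summit.CriticalPhenomena.SAWScalingLimit.Theses.SAWDevelopingMap

open scoped BigOperators Topology Manifold Classical MeasureTheory ProbabilityTheory Matrix InnerProductSpace ComplexConjugate ContinuousMap
open Filter Set Function TopologicalSpace MeasureTheory

attribute [summit_statement] _root_.SAWScalingLimit

-- earlier HexObservableLimit (stmt-CriticalPhenomena-5420, replaced 2026-08-16T00:03:57Z -> stmt-CriticalPhenomena-14003): refuted by Summit.CriticalPhenomena.SAWScalingLimit.Theorems.SAWDefectDecoherenceHexObservableLimit_refuted @ b90fe791a4c9 — ∃ c : ℂ, c ≠ 0 ∧ ∀ (D : Literature.Probability.RandomPlanarGeometry.DobrushinDomain) (ρ : ℝ) (Λ : ℝ → Finset Literature.Probability.LatticeModels.HexVerte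
/-- item stmt-CriticalPhenomena-14003 · target · rank 0 · open · by planner
why it might fail: DCS 2012 Conj. 2 (typed, ψ-averaged, pinned at a and b), open since 2010: false if subsequential limits of F_δ keep a dz̄-part (¬InteriorFlattening) or if collar decorations off the pinned balls shift ⟨ψ,F⟩/F(b) at leading order; c universal only for the rigid half-lattice class built in at a, b.
sources: DuminilCopinSmirnov2012, arXiv:1007.0575, Smirnov2007ICM, KennedyLawler2013, Summit.CriticalPhenomena.SAWScalingLimit.Theorems.SAWDefectDecoherenceHexObservableLimit_refuted
[target] repaired HexObservableLimit (stmt-CriticalPhenomena-5420, refuted-misstated by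
Summit.CriticalPhenomena.SAWScalingLimit.Theorems.SAWDefectDecoherenceHexObservableLimit_refuted —
the corridor witness: with Λ_δ free in the o(1)-collar at ∂Ω a boundary-hugging width-1 corridor
with a moat relocates the conformally effective root (3/4 → 1/2 on the half-disc) while every old
hypothesis holds, so the universal c ≠ 0 forces z(p−q)(1−pq) = 0). DCS 2012 Conjecture 2 (hexagonal
lattice), averaged against bulk test functions ψ ∈ C_c(Ω) and normalised at one boundary mid-edge
b_δ, with the ROOT PINNED CONFORMALLY exactly as b already was: for BOTH marked points p_i (i = 0
the root a, i = 1 the normalisation point b) the domain is the horizontal half-plane piece {im z >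
im p_i} inside the ball B(p_i, ρ) and the discretisation is the exact half-lattice there (v ∈ Λ_δ ↔
row(v) ≥ m_i(δ)); otherwise as before — ∃ c ≠ 0 universal with δ²⟨ψ, F_δ⟩/F_δ(b_δ) → c ∫ ψ
exp((5/8)(L − L_b)) for every such Dobrushin domain, every admissible discretisation family (simply
connected, connected, inside Ω, exhausting compacts), boundary mid-edges a_δ → a, b_δ → b, φ: a ↦ ∞,
b ↦ 0, L = log φ' continuous wi -/
@[route_item "route-CriticalPhenomena-SAWDevelopingMap", crux]
def HexObservableLimit : Prop :=
  ∃ c : ℂ, c ≠ 0 ∧ ∀ (D : Literature.Probability.RandomPlanarGeometry.DobrushinDomain) (ρ : ℝ) (Λ : ℝ → Finset Literature.Probability.LatticeModels.HexVertex) (m : Fin 2 → ℝ → ℤ) (a b : ℝ → Sym2 Literature.Probability.LatticeModels.HexVertex) (Φ : Literature.Probability.RandomPlanarGeometry.ConformalEquiv D.carrier UpperHalfPlane.upperHalfPlaneSet) (L : ℂ → ℂ) (Lb : ℂ) (ψ : ℂ → ℂ), let F : ℝ → Sym2 Literature.Probability.LatticeModels.HexVertex → ℂ := fun δ z => Literature.Probability.RandomPlanarGeometry.SAW.hexParafermionicObservable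 (Λ δ) (a δ) Literature.Probability.RandomPlanarGeometry.SAW.hexCriticalFugacity (5 / 8) z; 0 < ρ → (∀ i : Fin 2, D.carrier ∩ Metric.ball (D.pt i) ρ = {z : ℂ | (D.pt i).im < z.im} ∩ Metric.ball (D.pt i) ρ) → (∀ᶠ δ : ℝ in nhdsWithin 0 (Set.Ioi 0), Literature.Probability.RandomPlanarGeometry.SAW.hexDomainSimplyConnected (Λ δ) ∧ a δ ∈ Literature.Probability.RandomPlanarGeometry.SAW.hexDomainBoundary (Λ δ) ∧ b δ ∈ Literature.Probability.RandomPlanarGeometry.SAW.hexDomainBoundary (Λ δ) ∧ Nonempty (Literature.Probability.RandomPlanarGeometry.SAW.HexMidEdgeSAW (Λ δ) (a δ) (b δ)) ∧ (Literature.Probability.LatticeModels.hexGraph.induce ((Λ δ : Finset Literature.Probability.LatticeModels.HexVertex) : Set Literature.Probability.LatticeModels.HexVertex)).Preconnected ∧ (∀ v ∈ Λ δ, (δ : ℂ) * Literature.Probability.LatticeModels.hexCenter v ∈ D.carrier) ∧ (∀ i : Fin 2, ∀ v : Literature.Probability.LatticeModels.HexVertex, (δ : ℂ) * Literature.Probability.LatticeModels.hexCenter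 v ∈ Metric.ball (D.pt i) ρ → (v ∈ Λ δ ↔ m i δ ≤ v.1 1))) → (∀ K : Set ℂ, IsCompact K → K ⊆ D.carrier → ∀ᶠ δ : ℝ in nhdsWithin 0 (Set.Ioi 0), ∀ v : Literature.Probability.LatticeModels.HexVertex, (δ : ℂ) * Literature.Probability.LatticeModels.hexCenter v ∈ K → v ∈ Λ δ) → Filter.Tendsto (fun δ : ℝ => (δ : ℂ) * Literature.Probability.RandomPlanarGeometry.SAW.hexMidpoint (a δ)) (nhdsWithin 0 (Set.Ioi 0)) (nhds (D.pt 0)) → Filter.Tendsto (fun δ : ℝ => (δ : ℂ) * Literature.Probability.RandomPlanarGeometry.SAW.hexMidpoint (b δ)) (nhdsWithin 0 (Set.Ioi 0)) (nhds (D.pt 1)) → Filter.Tendsto (fun x => ‖Φ x‖) (nhdsWithin (D.pt 0) D.carrier) Filter.atTop → Φ.HasBoundaryValue (D.pt 1) 0 → ContinuousOn L D.carrier → (∀ z ∈ D.carrier, Complex.exp (L z) = deriv Φ z) → Filter.Tendsto L (nhdsWithin (D.pt 1) D.carrier) (nhds Lb) → Continuous ψ → HasCompactSupport ψ → tsupport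 ψ ⊆ D.carrier → Filter.Tendsto (fun δ : ℝ => (δ : ℂ) ^ 2 * (∑ᶠ e ∈ Literature.Probability.RandomPlanarGeometry.SAW.hexDomainMidEdges (Λ δ), ψ ((δ : ℂ) * Literature.Probability.RandomPlanarGeometry.SAW.hexMidpoint e) * F δ e) / F δ (b δ)) (nhdsWithin 0 (Set.Ioi 0)) (nhds (c * ∫ z, ψ z * Complex.exp ((5 / 8 : ℂ) * (L z - Lb))))

/-- item stmt-CriticalPhenomena-8296 · crux · rank 2 · open · by planner
why it might fail: Uniform over ALL simply connected Λ, a, v (fjords, pocket mouths too): source half = one number Z_{Hex∖v}(q→r;x_c) < sin(π/8) (observed ≤0.081, rigorous ≲1/2); bulk half (observed ≤0.6145≈β_T/α_T, domains ≤97 vertices) can fold by coherent cancellation of first-arrival amplitudes (22.5° steps).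
sources: DuminilCopinSmirnov2012, Floater2002, GortlerGotsmanThurston2006, RodinSullivan1987, Summits/CriticalPhenomena/SAWScalingLimit/Ideas/_closed/parafermion-developing-map-no-folds.md, arXiv:1007.0575
[crux] (K), card item K1 — "the parafermion never folds, uniformly": there is k < 1 such that for
every finite vertex set Λ with connected complement (simply connected hexagonal domain), every
boundary mid-edge a, every vertex v ∈ Λ and every labelling w₀, w₁, w₂ of its three neighbours, the
observable F = hexParafermionicObservable Λ a x_c (5/8) satisfies ‖F{v,w₀} + ωF{v,w₁} + ω²F{v,w₂}‖ ≤
k·‖F{v,w₀} + F{v,w₁} + F{v,w₂}‖, ω = exp(2πi/3) (one orientation class is 0 by Lemma 1, the other is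
the Beltrami mode: |μ_v| ≤ k, i.e. H_δ is K-quasiconformal, K = (1+k)/(1−k)). [difficulty:
open-problem] -/
@[route_item "route-CriticalPhenomena-SAWDevelopingMap", crux]
def NoFoldBound : Prop :=
  ∃ k : ℝ, k < 1 ∧ ∀ (Λ : Finset Literature.Probability.LatticeModels.HexVertex), Literature.Probability.RandomPlanarGeometry.SAW.hexDomainSimplyConnected Λ → ∀ a ∈ Literature.Probability.RandomPlanarGeometry.SAW.hexDomainBoundary Λ, ∀ v ∈ Λ, ∀ w₀ w₁ w₂ : Literature.Probability.LatticeModels.HexVertex, Literature.Probability.LatticeModels.hexGraph.Adj v w₀ → Literature.Probability.LatticeModels.hexGraph.Adj v w₁ → Literature.Probability.LatticeModels.hexGraph.Adj v w₂ → w₀ ≠ w₁ → w₁ ≠ w₂ → w₀ ≠ w₂ → let F : Sym2 Literature.Probability.LatticeModels.HexVertex → ℂ := Literature.Probability.RandomPlanarGeometry.SAW.hexParafermionicObservable Λ a Literature.Probability.RandomPlanarGeometry.SAW.hexCriticalFugacity (5 / 8); let ω : ℂ := Complex.exp (2 * Real.pi * Complex.I / 3); ‖F s(v, w₀) + ω *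 F s(v, w₁) + ω ^ 2 * F s(v, w₂)‖ ≤ k * ‖F s(v, w₀) + F s(v, w₁) + F s(v, w₂)‖

/-- item stmt-CriticalPhenomena-8297 · crux · rank 3 · open · by planner
why it might fail: DCS curl-vanishing (1007.0575 p.7) made POINTWISE, uniform in (Λ,a) at fixed lattice depth: stronger than the in-measure form qc good-approximation needs (AIM Lem 5.3.5); σ=1/2 FK-Ising analogue false on lattice (edge values = projections, 0910.2045 §2.2); exact data to depth 4 only (|μ|≈0.1–0.3).
sources: DuminilCopinSmirnov2012, arXiv:1007.0575, DuminilCopin2013Parafermion, arXiv:0910.2045, ChelkakSmirnov2012Ising, Literature.Barriers.CriticalPhenomena.ParafermionicHalfCauchyRiemann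
[crux] (M), card item K2 — bulk flattening, pointwise and uniform: for every ε > 0 there is R such
that for every simply connected Λ, boundary mid-edge a and vertex v whose Euclidean R-ball of
lattice vertices lies in Λ, the same Beltrami quotient is ≤ ε: ‖F{v,w₀} + ωF{v,w₁} + ω²F{v,w₂}‖ ≤
ε‖ΣF‖ for every labelling — the three mid-edge values around a deep vertex equalise (DCS p. 7: "the
same limit regardless of the orientation of the edge"), i.e. the three first-arrival port amplitudes
equalise at depth R. [difficulty: open-problem] -/
@[route_item "route-CriticalPhenomena-SAWDevelopingMap", crux]
def InteriorFlattening : Prop :=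
  ∀ ε : ℝ, 0 < ε → ∃ R : ℝ, ∀ (Λ : Finset Literature.Probability.LatticeModels.HexVertex), Literature.Probability.RandomPlanarGeometry.SAW.hexDomainSimplyConnected Λ → ∀ a ∈ Literature.Probability.RandomPlanarGeometry.SAW.hexDomainBoundary Λ, ∀ v ∈ Λ, (∀ w : Literature.Probability.LatticeModels.HexVertex, dist (Literature.Probability.LatticeModels.hexCenter w) (Literature.Probability.LatticeModels.hexCenter v) ≤ R → w ∈ Λ) → ∀ w₀ w₁ w₂ : Literature.Probability.LatticeModels.HexVertex, Literature.Probability.LatticeModels.hexGraph.Adj v w₀ → Literature.Probability.LatticeModels.hexGraph.Adj v w₁ → Literature.Probability.LatticeModels.hexGraph.Adj v w₂ → w₀ ≠ w₁ → w₁ ≠ w₂ → w₀ ≠ w₂ → let F : Sym2 Literature.Probability.LatticeModels.HexVertex → ℂ := Literature.Probability.RandomPlanarGeometry.SAW.hexParafermionicObservable Λ a Literature.Probability.RandomPlanarGeometry.SAW.hexCriticalFugacity (5 / 8); let ω : ℂ := Complex.exp (2 * Real.pi * Complex.I / 3); ‖F s(v, w₀) + ω * F s(v, w₁) + ω ^ 2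 * F s(v, w₂)‖ ≤ ε * ‖F s(v, w₀) + F s(v, w₁) + F s(v, w₂)‖

/-- item stmt-CriticalPhenomena-8298 · crux · rank 4 · open · by planner
why it might fail: Boundary: the exact per-edge direction law mixes edge types on a staircase boundary with Kennedy–Lawler length factors, so lim Π_δ has the (3/8)θ tangent law only if Σ n_iℓ_i sin((3/8)(θ_i−θ_n)) = 0 per slope; zigzag-polygonal Ω are rigid, general Jordan Ω and the pole at a are not.
sources: KennedyLawler2013, RodinSullivan1987, HeSchramm1996, AstalaIwaniecMartin2008, LehtoVirtanen1973, Pommerenke1992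
[crux] (Id), card item K3 — compactness-and-identification: (K) and (M) imply HexObservableLimit.
Scheme: (K) makes the normalised maps H_δ/F_δ(b_δ) a uniformly K-qc family of PL homeomorphisms onto
simple polygons Π_δ (normal family, equi-Hölder); (M) makes subsequential limits conformal in Ω
(good approximation); the exact boundary winding gives Π_δ the edge-direction law (3/8)θ_ν(p) +
(5/8)θ(a), so for zigzag-polygonal Ω the limit polygon has angles π(5/8 + (3/8)α_j) with corner
correspondence and Schwarz–Christoffel forces h′ = c(φ′)^(5/8) with NO length data; general Jordan Ω
by boundary-factor balance or approximation; F_δ is read off dH_δ in the ψ-averaged sense. [deps: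
NoFoldBound, InteriorFlattening, PotentialExists] [difficulty: XL] -/
@[route_item "route-CriticalPhenomena-SAWDevelopingMap", crux]
def QCIdentification : Prop :=
  NoFoldBound → InteriorFlattening → HexObservableLimit

/-- item stmt-CriticalPhenomena-5423 · crux · rank 5 · open · by planner
why it might fail: No RSW/annulus-crossing technology for SAW (n = 0: no FKG; KS17 §4 covers FK, percolation, harmonic explorer, LERW; G2 fails for UST §4.5); strongest inputs: sub-ballisticity (DCH13, arXiv:2310.17299). Eventual form avoids refuted all-δ item 0772.
sources: KemppainenSmirnov2017, DuminilCopinHammond2013, arXiv:2310.17299, arXiv:1212.6215, Summit.CriticalPhenomena.SAWScalingLimit.Theorems.SAWParafermionTight_refuted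
[crux] eventual tightness of the critical hexagonal SAW laws: for every Dobrushin domain and
hexagonal endpoint approximation (IsEmbEndpointApprox hexGraph hexCenter), the family δ ↦ hexSAWLaw
pushed to CurveClass ℂ is tight along 𝓝[>]0 (IsTightAlongMesh — NOT the refuted all-δ IsTightLaws
form of stmt-CriticalPhenomena-0772). [difficulty: open-problem] -/
@[route_item "route-CriticalPhenomena-SAWDevelopingMap", crux]
def HexTight : Prop :=
  ∀ (D : Literature.Probability.RandomPlanarGeometry.DobrushinDomain) (a b : ℝ → Literature.Probability.LatticeModels.HexVertex), Literature.Probability.RandomPlanarGeometry.SAW.IsEmbEndpointApprox Literature.Probability.LatticeModels.hexGraph Literature.Probability.LatticeModels.hexCenter D a b → Literature.Probability.RandomPlanarGeometry.IsTightAlongMesh (fun δ (γ : Literature.Probability.RandomPlanarGeometry.SAW.HexDomainSAW D.carrier δ (a δ) (b δ)) => γ.curve) (fun δ => Literature.Probability.RandomPlanarGeometry.SAW.hexSAWLaw D.carrier δ (a δ) (b δ))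

-- earlier ObservableToSLE (stmt-CriticalPhenomena-5424, replaced 2026-08-15T16:16:35Z -> stmt-CriticalPhenomena-10472): retired by None — HexObservableLimit → HexTight → Literature.Probability.RandomPlanarGeometry.SAW.HexSAWScalingLimit
/-- item stmt-CriticalPhenomena-10472 · crux · rank 6 · open · by planner
why it might fail: Martingale F_{Ω∖γ[0,n]}(·)/F(b) lives in SLIT domains (not Jordan: outside HexObservableLimit's ∀ DobrushinDomain), source at the rough tip, needs Carathéodory-uniform convergence; projective data fix κ=8/3, not the drift: flat-b normalisation load-bearing; DCS: Conj.2 only 'a major step' to Conj.1.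
sources: LawlerSchrammWerner2003, KemppainenSmirnov2017, DuminilCopinSmirnov2012Clay, Smirnov2007ICM, DuminilCopinSmirnov2012, arXiv:math/0209343
[crux] the martingale-observable identification for the hexagonal SAW: HexObservableLimit → HexTight
→ (Duminil-Copin–Smirnov 2012 Conjecture 1 written out: for every Dobrushin domain and hexagonal
endpoint approximation the critical hexagonal SAW law hexSAWLaw, pushed to CurveClass ℂ, converges
in law to chordal SLE(8/3) — verbatim the definiens of Literature HexSAWScalingLimit and of the
shared item HexConjecture, stmt-CriticalPhenomena-0808; rev 2 restatement of
stmt-CriticalPhenomena-5424, Iff.rfl-equivalent, so that the route's dependency cone bottoms out in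
its own items): the b-normalised observable ⟨ψ, F_(Ω∖γ[0,n])⟩/F_(Ω∖γ[0,n])(b) is an exact discrete
martingale (domain Markov property of the SAW), its limit c⟨ψ,(φ_n'/φ_n'(b))^(5/8)⟩ forces the
driving process of every subsequential limit to be √(8/3)B (LSW03 Prop. 5.2 / Itô on g_t'^(5/8)(g_t
− W_t)^(−5/4)), and tightness + uniqueness of the SLE law conclude (SLEConvergenceCriterion). [deps:
HexObservableLimit, HexTight] [difficulty: XL] -/
@[route_item "route-CriticalPhenomena-SAWDevelopingMap", crux]
def ObservableToSLE : Prop :=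
  HexObservableLimit → HexTight → ∀ (D : Literature.Probability.RandomPlanarGeometry.DobrushinDomain) (a b : ℝ → Literature.Probability.LatticeModels.HexVertex), Literature.Probability.RandomPlanarGeometry.SAW.IsEmbEndpointApprox Literature.Probability.LatticeModels.hexGraph Literature.Probability.LatticeModels.hexCenter D a b → Literature.Probability.RandomPlanarGeometry.ConvergesInLawToSLE ((8 : NNReal) / 3) D (fun δ (γ : Literature.Probability.RandomPlanarGeometry.SAW.HexDomainSAW D.carrier δ (a δ) (b δ)) => γ.curve) (fun δ => Literature.Probability.RandomPlanarGeometry.SAW.hexSAWLaw D.carrier δ (a δ) (b δ))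

/-- item stmt-CriticalPhenomena-14221 · crux · rank 7 · open · by planner
why it might fail: Open content = lattice universality ℤ² vs Hex of the critical SAW law: uniform ℤ² SAW lies in no Yang–Baxter family (GM19 p.1; barrier NienhuisWeightsExcludeVertexSAW), so no transfer tool exists even given the Hex SLE(8/3) limit; Kennedy–Lawler boundary effects could split ℤ² endpoint classes.
sources: GlazmanManolescu2019, KennedyLawler2013, DuminilCopinSmirnov2012, LawlerSchrammWerner2004SAW, Literature.Barriers.CriticalPhenomena.NienhuisWeightsExcludeVertexSAW, Literature.Barriers.CriticalPhenomena.not_hasExactVertexRelationZ2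
[crux] LATTICE-UNIVERSALITY TRANSFER (conjecture-grade: filed with kind support at rev 7 only
because the at-edit cap check counted 8 with it declared crux; the gate auto-promotes
conjecture-grade items to crux, intended rank 7 — a retriage follows if needed; rev 7 route choice;
replaces in THIS route the shared tail HexConjecture stmt-0808 → HexToSquare stmt-10473 +
LatticeUniversality stmt-0807, which stays with the sibling routes SAWDefectDecoherence /
SAWResidueField / SAWWindingAlias / SAWDevelopingMap): Duminil-Copin–Smirnov 2012 Conjecture 1 —
written out verbatim as the conclusion of ObservableToSLER (for every Dobrushin domain and hexagonal
endpoint approximation IsEmbEndpointApprox the critical hexagonal SAW law hexSAWLaw, pushed to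
CurveClass ℂ, converges in law to chordal SLE(8/3)) — IMPLIES the δℤ² sub-problem statement
SAWScalingLimit. Universality of the critical SAW scaling limit in exactly the implicational form
the assembly needs: weaker than the asymptotic equality of laws LatticeUniversality (it may use
existence and conformal invariance of the hexagonal limit), Iff.rfl-equivalent to HexConjecture →
SAWScalingLimit, implied by HexToSquare ∧ LatticeUniversality ( -/
@[route_item "route-CriticalPhenomena-SAWDevelopingMap", crux]
def HexTransfer : Prop :=
  (∀ (D : Literature.Probability.RandomPlanarGeometry.DobrushinDomain) (a b : ℝ → Literature.Probability.LatticeModels.HexVertex), Literature.Probability.RandomPlanarGeometry.SAW.IsEmbEndpointApprox Literature.Probability.LatticeModels.hexGraph Literature.Probability.LatticeModels.hexCenter D a b → Literature.Probability.RandomPlanarGeometry.ConvergesInLawToSLE ((8 : NNReal) / 3) D (fun δ (γ : Literature.Probability.RandomPlanarGeometry.SAW.HexDomainSAW D.carrier δ (a δ) (b δ)) => γ.curve) (fun δ => Literature.Probability.RandomPlanarGeometry.SAW.hexSAWLaw D.carrier δ (a δ) (b δ))) → SAWScalingLimit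

/-- item stmt-CriticalPhenomena-0808 · crux · rank 9 · open · by planner
why it might fail: = DCS 2012 Conj. 1, open since 2010: needs tightness of the critical hexagonal SAW (no RSW/FKG at n = 0; 'conjectural' per arXiv:2310.17299) AND identification; the parafermion obeys only half of discrete CR (barrier HalfCR); closes here only via HexObservableLimit, HexTight, ObservableToSLE.
sources: DuminilCopinSmirnov2012, arXiv:1007.0575, LawlerSchrammWerner2004SAW, arXiv:2310.17299, Literature.Barriers.CriticalPhenomena.ParafermionicHalfCauchyRiemann, Literature.Probability.RandomPlanarGeometry.SAW.HexSAWScalingLimit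
[crux] r3 (informal until defn HexSAWLaw lands): Duminil-Copin–Smirnov 2012 Conjecture 1 verbatim
(arXiv:1007.0575 p.9): let Ω ≠ ℂ be simply connected (here: a Dobrushin domain) with boundary points
a, b; Ω_δ the largest finite domain of δHex inside Ω, a_δ, b_δ the vertices of Ω_δ closest to a, b;
for x = x_c = 1/√(2+√2) the law of the SAW γ_δ in (Ω_δ, a_δ, b_δ) with weight ∝ x^{ℓ(γ)} converges
as δ → 0 to chordal SLE(8/3) in Ω from a to b
(Literature.Probability.RandomPlanarGeometry.ConvergesInLawToSLE (8/3)). -/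
@[route_item "route-CriticalPhenomena-SAWDevelopingMap", crux]
def HexConjecture : Prop :=
  ∀ (D : Literature.Probability.RandomPlanarGeometry.DobrushinDomain) (a b : ℝ → Literature.Probability.LatticeModels.HexVertex), Literature.Probability.RandomPlanarGeometry.SAW.IsEmbEndpointApprox Literature.Probability.LatticeModels.hexGraph Literature.Probability.LatticeModels.hexCenter D a b → Literature.Probability.RandomPlanarGeometry.ConvergesInLawToSLE ((8 : NNReal) / 3) D (fun δ (γ : Literature.Probability.RandomPlanarGeometry.SAW.HexDomainSAW D.carrier δ (a δ) (b δ)) => γ.curve) (fun δ => Literature.Probability.RandomPlanarGeometry.SAW.hexSAWLaw D.carrier δ (a δ) (b δ))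

/-- item stmt-CriticalPhenomena-18669 · support · rank 6 · open · by planner
[crux] BAND-WISE RENEWAL (conditional) — the research leaf R1 `stub_bandRenewal` of the live line
six-class-type-ladder r16, verbatim: given the route's observable limit (HexObservableLimit),
tightness (HexTight) and simplicity of subsequential limits (item 7148), for every Dobrushin domain
and endpoint approximation there are ONE window class j and base point z₀ ∈ D such that at EACH
marked point the per-band bound `TypeLadder.BandBoundAt` holds (…TypeLadderBandDefs.lean, landed
vocabulary p168396): ∃ c₀ < 1, θ > 1, R₂ > 0, ∀ R ≤ R₂ ∀ P ≤ R ∀ ρin ≤ P/(2θ) ∃ ρw ∀ ρ ≤ ρw ∃ N ∀ᶠ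
δ, ∃ a band family on [ρin, θ·ρin] such that, UNIFORMLY over self-avoiding pasts confined to the
closed inner ball, the carved law of the future gives mass ≤ c₀ to “no clean first exit from a level
of the family without return before distance P (with a z₀-escape)”. With the LANDED
no-macroscopic-backtracking theorem (p168181) and the LANDED band iteration I8
(…TypeLadderBandIteration.lean) it yields the abundance residue (item 17698's body); continuum
shadow: void probability of the 3/4-stable regenerative set of bridge scales over [ρin, θρin]
(Alberts–Duminil-Copin); flat half-plane floor: bridge band-mass o -/
@[route_item "route-CriticalPhenomena-SAWDevelopingMap"]
def BandRenewalC : Prop :=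
  Summit.CriticalPhenomena.SAWScalingLimit.Theses.SAWDevelopingMap.HexObservableLimit → Summit.CriticalPhenomena.SAWScalingLimit.Theses.SAWDevelopingMap.HexTight → (∀ (D : Literature.Probability.RandomPlanarGeometry.DobrushinDomain) (a b : ℝ → Literature.Probability.LatticeModels.HexVertex), Literature.Probability.RandomPlanarGeometry.SAW.IsEmbEndpointApprox Literature.Probability.LatticeModels.hexGraph Literature.Probability.LatticeModels.hexCenter D a b → ∀ (s : ℕ → ℝ) (ν : MeasureTheory.Measure (Literature.Probability.RandomPlanarGeometry.CurveClass ℂ)), Filter.Tendsto s Filter.atTop (nhdsWithin 0 (Set.Ioi 0)) → MeasureTheory.IsProbabilityMeasure ν → (∀ f : BoundedContinuousFunction (Literature.Probability.RandomPlanarGeometry.CurveClass ℂ) ℝ, Filter.Tendsto (fun n => ∫ γ, f γ.curve ∂(Literature.Probability.RandomPlanarGeometry.SAW.hexSAWLaw D.carrier (s n) (a (s n)) (b (s n)))) Filter.atTop (nhds (∫ x, f x ∂ν))) → ∀ᵐ γ ∂ν, γ ∈ Literature.Probability.RandomPlanarGeometry.CurveClass.simple ∧ γ.source = D.pt 0 ∧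 γ.target = D.pt 1 ∧ γ.range ⊆ closure D.carrier ∧ γ.range ∩ frontier D.carrier ⊆ {D.pt 0, D.pt 1}) → ∀ (D : Literature.Probability.RandomPlanarGeometry.DobrushinDomain) (a b : ℝ → Literature.Probability.LatticeModels.HexVertex), Literature.Probability.RandomPlanarGeometry.SAW.IsEmbEndpointApprox Literature.Probability.LatticeModels.hexGraph Literature.Probability.LatticeModels.hexCenter D a b → Summit.CriticalPhenomena.SAWScalingLimit.Theorems.ObservableToSLE.TypeLadder.BandRenewal D a b

/-- item stmt-CriticalPhenomena-8299 · support · rank 9 · closed · proved by Summit.CriticalPhenomena.SAWScalingLimit.Theorems.potentialExists_proof (prover) · by planner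
sources: DuminilCopinSmirnov2012, Literature.Probability.RandomPlanarGeometry.SAW.DuminilCopinSmirnov2012_lemma1, GortlerGotsmanThurston2006
[support] the potential lemma, F = dH (card P1): for every simply connected Λ and boundary mid-edge
a there is H : Site 2 → ℂ (values at the hexagon centres = sites of 𝕋) such that for every v ∈ Λ,
every neighbour w and the shared 𝕋-edge {s, t} = hexFaceVertices v ∩ hexFaceVertices w oriented with
the centre of v on its LEFT, H t − H s = (hexMidpoint {v,w} − hexCenter v)·F{v,w}. Proof: closedness
on each triangle of Λ is Lemma 1 (DuminilCopinSmirnov2012_lemma1_holds); exactness is the discrete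
Poincaré lemma on the union K_Λ of the closed triangles of Λ (its planar complement is connected
since Λᶜ is preconnected in ℍ, so H¹(K_Λ) = 0); interior edges are consistent because the mid-point
is the mean of the two centres. With H affine on Δ_v: ΣF = 6i√3 ∂H, Beltrami mode = −6i√3(ē₀/e₀)∂̄H.
[difficulty: M] -/
@[route_item "route-CriticalPhenomena-SAWDevelopingMap"]
def PotentialExists : Prop :=
  ∀ (Λ : Finset Literature.Probability.LatticeModels.HexVertex), Literature.Probability.RandomPlanarGeometry.SAW.hexDomainSimplyConnected Λ → ∀ a ∈ Literature.Probability.RandomPlanarGeometry.SAW.hexDomainBoundary Λ, ∃ H : Literature.Probability.LatticeModels.Site 2 → ℂ, ∀ v ∈ Λ, ∀ w : Literature.Probability.LatticeModels.HexVertex, Literature.Probability.LatticeModels.hexGraph.Adj v w → ∀ s t : Literature.Probability.LatticeModels.Site 2, s ∈ Literature.Probability.LatticeModels.hexFaceVertices v → t ∈ Literature.Probability.LatticeModels.hexFaceVertices v → s ∈ Literature.Probability.LatticeModels.hexFaceVertices w → t ∈ Literature.Probability.LatticeModels.hexFaceVertices w → s ≠ t → 0 < ((starRingEnd ℂ) (Literature.Probability.LatticeModels.triEmbed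 t - Literature.Probability.LatticeModels.triEmbed s) * (Literature.Probability.LatticeModels.hexCenter v - Literature.Probability.LatticeModels.triEmbed s)).im → H t - H s = (Literature.Probability.RandomPlanarGeometry.SAW.hexMidpoint s(v, w) - Literature.Probability.LatticeModels.hexCenter v) * Literature.Probability.RandomPlanarGeometry.SAW.hexParafermionicObservable Λ a Literature.Probability.RandomPlanarGeometry.SAW.hexCriticalFugacity (5 / 8) s(v, w)

-- `PotentialExists` holds: proved by `Summit.CriticalPhenomena.SAWScalingLimit.Theorems.potentialExists_proof` (its module imports this route file, so no `_holds` link can be stated here).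

/-- item stmt-CriticalPhenomena-8300 · support · rank 9 · open · by planner
sources: DuminilCopinSmirnov2012, MadrasSlade1993, BeatonBousquetMelouDeGierDuminilCopinGuttmann2014, Summits/CriticalPhenomena/SAWScalingLimit/Ideas/_closed/parafermion-developing-map-no-folds.md
[support] the source-vertex part of (K) as a critical polygon inequality (card K1, sharpened form):
there is c < sin(π/8) = 0.38268… such that for every simply connected Λ, every u ∉ Λ adjacent to v ∈
Λ (so a = {u,v} is a boundary mid-edge) and the two other neighbours w₁, w₂ of v, the critical
generating function Z = Σ_γ x_c^(ℓ(γ)) of self-avoiding walks of Λ∖{v} from the mid-edge {v,w₁} to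
the mid-edge {v,w₂} (returning loops around v; deterministic winding, so Z > 0 carries the whole
phase) is ≤ c. Exact source law: with L = x_c Z the triple at v is (1, x_c e^(−iπσ/3) + L
e^(−5iπ/6), c.c.) (q the left turn), so ΣF = α_T − √3L, Beltrami mode = β_T + √3L, and NoFoldBound
at v ⇔ L < x_c sin(π/8) ⇔ Z < sin(π/8); the DCS sum rule in Λ∖{v} gives only Z ≲ 0.92, observed Z ≤
0.081, smallest loop x_c^5 = 0.046. [difficulty: L] -/
@[route_item "route-CriticalPhenomena-SAWDevelopingMap", crux]
def SourceLoopBound : Prop :=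
  ∃ c : ℝ, c < Real.sin (Real.pi / 8) ∧ ∀ (Λ : Finset Literature.Probability.LatticeModels.HexVertex), Literature.Probability.RandomPlanarGeometry.SAW.hexDomainSimplyConnected Λ → ∀ u v w₁ w₂ : Literature.Probability.LatticeModels.HexVertex, u ∉ Λ → v ∈ Λ → Literature.Probability.LatticeModels.hexGraph.Adj v u → Literature.Probability.LatticeModels.hexGraph.Adj v w₁ → Literature.Probability.LatticeModels.hexGraph.Adj v w₂ → u ≠ w₁ → u ≠ w₂ → w₁ ≠ w₂ → (∑ γ : Literature.Probability.RandomPlanarGeometry.SAW.HexMidEdgeSAW (Λ.erase v) s(v, w₁) s(v, w₂), Literature.Probability.RandomPlanarGeometry.SAW.hexCriticalFugacity ^ γ.length) ≤ c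

-- earlier Assembly (stmt-CriticalPhenomena-14071, replaced 2026-08-16T05:45:31Z -> stmt-CriticalPhenomena-14674): retired by None — NoFoldBound → InteriorFlattening → HexTight → LatticeUniversality → SAWScalingLimit
-- earlier Assembly (stmt-CriticalPhenomena-8301, replaced 2026-08-16T00:14:53Z -> stmt-CriticalPhenomena-14071): retired by None — NoFoldBound → InteriorFlattening → QCIdentification → HexTight → ObservableToSLE → HexToSquare → LatticeUniversality → SAWScalingLimit
/-- item stmt-CriticalPhenomena-14674 · assembly · rank 1 · open · by planner
sources: DuminilCopinSmirnov2012, KemppainenSmirnov2017, GlazmanManolescu2019, RodinSullivan1987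
[assembly] the non-glue frame statement (rev 13; restated because its rev-7 form
stmt-CriticalPhenomena-14071 named the crux LatticeUniversality, dropped from this route at rev 13):
the line's two estimates, tightness and the tail suffice — NoFoldBound (K) → InteriorFlattening (M)
→ HexTight → HexTransfer → SAWScalingLimit. Proved exactly by the route's two glue cruxes once they
land: `fun hK hM hT hX => hX (ObservableToSLE_holds (QCIdentification_holds hK hM) hT)` (term
checked against the glue items as hypotheses in the seat's Sketch.lean, rc 0); no ground battery
closes or refutes it (it needs QCIdentification and ObservableToSLE). Not a hypothesis of `closes`,
which binds the six cruxes directly. [deps: QCIdentification, ObservableToSLE, HexTransfer] -/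
@[route_item "route-CriticalPhenomena-SAWDevelopingMap"]
def Assembly : Prop :=
  NoFoldBound → InteriorFlattening → HexTight → HexTransfer → SAWScalingLimit

-- records of items no longer active in this route (dropped / restated):
-- earlier LatticeUniversality (stmt-CriticalPhenomena-0807, replaced 2026-08-16T05:45:31Z -> stmt-CriticalPhenomena-14221): open — ∀ (D : Literature.Probability.RandomPlanarGeometry.DobrushinDomain) (a b : ℝ → Literature.Probability.LatticeModels.Site 2) (a' b' : ℝ → Literature.Probability.LatticeModels.HexVertex), Literature.Probability.RandomPlanarGeometry.SAW.IsEndpointApprox D a b → Literature.P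
-- earlier HexToSquare (stmt-CriticalPhenomena-5428, replaced 2026-08-15T16:16:35Z -> stmt-CriticalPhenomena-10473): retired by None — Literature.Probability.RandomPlanarGeometry.SAW.HexSAWScalingLimit → LatticeUniversality → SAWScalingLimit

/-! D-0027 §2.1 — DECIDING THEOREM (planner-authored via `route open/edit --closes-file`; by planner-rchoice-CriticalPhenomena-SAWDevelopin-2b584797-0 2026-08-16T05:45:31Z):
its hypotheses are this route's items and its conclusion the sub-problem Statement (glue_lint), and it elaborates with this file. -/

@[closes "route-CriticalPhenomena-SAWDevelopingMap"] theorem closes : NoFoldBound → InteriorFlattening → QCIdentification → HexTight → ObservableToSLE → HexTransfer → _root_.SAWScalingLimit :=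
  fun hK hM hId hT hObs hX => hX (hObs (hId hK hM) hT)

end Summit.CriticalPhenomena.SAWScalingLimit.Theses.SAWDevelopingMap
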